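/-
Copyright (c) 2026. Released under Apache 2.0 license as described in the file LICENSE.
Track B ∕ K2-LIT (cell `hodgecm-mathlib`, squad K2, ENGINE E1), crux h413 = `stmt-HodgeConjecture-24833`, route of record `HCCMUnconditional`.
Prover seat `hodgecm-mathlib-K2E3-p12` (g7).  Deal «P8 PROPER» (closer, structural half): the per-ball DATA of ★ `sphericalEisenstein_meromorphicOn_ball_of_letters` for the CM datum, ★-closed.
-/
import Summits.HodgeConjecture.HodgeConjecture.Theorems.K2E1SphericalEisensteinMeromorphicSuppliersU2   -- ★ (this seat): `exists_heckePackage`, `exists_pos_forall_measure_setOf_lt_ne_zero_cm`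
import Summits.HodgeConjecture.HodgeConjecture.Theorems.K2E1SphericalHeckeSmoothTestFunctionU2         -- ★ P5c: `exists_symm_isTestFunctionGL_biInvariant_integral_ne_zero`
import Summits.HodgeConjecture.HodgeConjecture.Theorems.K2E1BLMeromorphicGluing                      -- ★ G-a (this seat): `exists_finset_forall_exists_ne_zero_closedBall`
import Summits.HodgeConjecture.HodgeConjecture.Theorems.K2E1BLQuotientMeasureU                        -- ★ `measurePreserving_rightShift_of_unfolding` (`hright`)
import Summits.HodgeConjecture.HodgeConjecture.Theorems.K2E1SphericalHeckeEigenSectionU2              -- ★ P5: `differentiable_integral_mul_borelHeight_cpow`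
import HarnessLib

/-!
# K2·E1 — `K2E1SphericalEisensteinMeromorphicBallDataCMTwo`: THE STRUCTURAL DATA OF ONE BALL FOR THE P8 CLOSER ON `U(1,1)` OVER A CM FIELD — levels `0 < a ≤ κ_i a` below both thresholds, a
# FINITE SYMMETRIC family of smooth bi-`K`-invariant test functions whose transforms `ĥ_i` have no common zero on the ball, their `𝔛`-side Hecke operators with the intertwining, the ι-package and
# `μZ(Z_a) ≠ 0` — ALL ★-discharged (no letter) [arXiv:1911.02342, §4 Claims 4–5 and p. 10]

Track B ∕ K2-LIT, crux h413 = `stmt-HodgeConjecture-24833`, route of record `HCCMUnconditional`; cell `hodgecm-mathlib`, squad K2, ENGINE E1 (campaign EIS-R7-BL-SPH-2, P8 PROPER closer,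
consumption plan 09:44:03Z).  Prover seat `hodgecm-mathlib-K2E3-p12` (g7).  THEOREMS ONLY (no `def`, no `instance`, no notation, no named-fact hypothesis, no `sorry`); lane
`--supports stmt-HodgeConjecture-24833 --as helper` (count-neutral).  Closes no socket.
WHAT.  For the ball `ball 0 (n + 2)` and the weight `k = n + 3` this file PRODUCES, from the structural data `(μ, νG, β, hβ, μZ, hμZ)` only, every structural binder of ★ P8 §2
`sphericalEisenstein_meromorphicOn_ball_of_letters`: §1 `exists_levels` (real-arithmetic choice `a = c⋆ ∕ (2(1 + sup κ))`); §2 `continuous_lift`, `hasCompactSupport_lift`, `integrable_lift` (the lift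
`x ↦ (η (adelicVal x) : ℂ)` of a `GL₂(𝔸_L)` test function to `U(J₂)(𝔸)`); §3 **`exists_ballData_cm_two (n)`** — `∃ a I i₀ η κ T` with: `0 < a`; every `η i` a smooth non-negative SYMMETRIC
bi-`K`-invariant test function (★ P5c ED. 2), no common zero of the `ĥ_i` on `ball 0 (n + 2)` (★ G-a finite subcover of the closed ball) and `ĥ_{i₀}(0) ≠ 0`; `1 ≤ κ i`; the `𝔛`-operators `T i`
with their a.e. formula and, at the levels `a ≤ κ_i a`, `ShiftBound` + the intertwining (★ `exists_heckePackage`, `hright` ★ from the unfolding); injectivity and closed range of `ι` at the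
levels `κ_i a` (★ `exists_pos_iota_closedEmbedding_cm`); `μZ(Z_a) ≠ 0` (★).  The closer adds the analytic letters (K1-L², P6′ (i), P3-D, S1) and calls ★ §2 and ★ §1.
HONEST LABEL: HC_CM is proved only modulo the 7 printed citations (2 remaining named inputs: hLiu418 = `stmt-HodgeConjecture-24832`, h413 = `stmt-HodgeConjecture-24833`) until rung 0
closes; this file asserts no named fact and closes no socket.
References: [BernsteinLapid2019] J. Bernstein, E. Lapid, *On the meromorphic continuation of Eisenstein series*, arXiv:1911.02342 (JAMS 37 (2024), doi:10.1090/jams/1020), §4 Claims 4–5, p. 10.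
-/

set_option autoImplicit false
-- the mandated namespace repeats the single-problem summit's segment (`HodgeConjecture.HodgeConjecture`)
set_option linter.dupNamespace false

noncomputable section

open MeasureTheory Filter Topology Set NumberField
open scoped NNReal ENNReal Classical
open Literature.MeasureTheory.Group Literature.NumberTheory Literature.NumberTheory.Automorphic Literature.NumberTheory.Automorphic.UnitaryGroup AdelicGroupData
open Summit.HodgeConjecture.HodgeConjecture.Cruxes.H413.K2E1BLBorelSpacesU2Defs
open Summit.HodgeConjecture.HodgeConjecture.Cruxes.H413.K2E1BLBorelOperatorsU2Defs
open Summit.HodgeConjecture.HodgeConjecture.Cruxes.H413.K2E1BLIotaClosedEmbeddingU2 (iotaBound_cm exists_pos_iota_closedEmbedding_cm)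
open Summit.HodgeConjecture.HodgeConjecture.Cruxes.H413.K2E1BLQuotientMeasureU (measurePreserving_rightShift_of_unfolding)
open Summit.HodgeConjecture.HodgeConjecture.Cruxes.H413.K2E1SphericalHeckeEigenSectionU2 (differentiable_integral_mul_borelHeight_cpow)
open Summit.HodgeConjecture.HodgeConjecture.Cruxes.H413.K2E1SphericalHeckeSmoothTestFunctionU2 (exists_symm_isTestFunctionGL_biInvariant_integral_ne_zero)
open Summit.HodgeConjecture.HodgeConjecture.Cruxes.H413.K2E1BLMeromorphicGluing (exists_finset_forall_exists_ne_zero_closedBall)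
open Summit.HodgeConjecture.HodgeConjecture.Cruxes.H413.K2E1SphericalEisensteinMeromorphicSuppliersU2 (exists_heckePackage exists_pos_forall_measure_setOf_lt_ne_zero_cm)

namespace Summit.HodgeConjecture.HodgeConjecture.Cruxes.H413.K2E1SphericalEisensteinMeromorphicBallDataCMTwo

/-! ## §1 Choice of the levels -/

/-- **LEVELS**: for a finite family of constants `κ i ≥ 1` and a threshold `c⋆ > 0` there is `a > 0` with `a ≤ κ_i a < c⋆` for all `i` (`a := c⋆ ∕ (2(1 + Σ κ))`). [folklore] -/
theorem exists_levels {I : Type} [Fintype I] (κ : I → ℝ≥0) (hκ : ∀ i, 1 ≤ κ i) {c : ℝ≥0} (hc : 0 < c) :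
    ∃ a : ℝ≥0, 0 < a ∧ a < c ∧ ∀ i, a ≤ κ i * a ∧ κ i * a < c := by
  have hS : ∀ i, (κ i : ℝ) ≤ ∑ j, (κ j : ℝ) := fun i => Finset.single_le_sum (f := fun j => (κ j : ℝ)) (fun j _ => NNReal.coe_nonneg _) (Finset.mem_univ i)
  have hS0 : (0 : ℝ) ≤ ∑ j, (κ j : ℝ) := Finset.sum_nonneg fun j _ => NNReal.coe_nonneg _
  have hcR : (0 : ℝ) < c := by exact_mod_cast hc
  obtain ⟨a, ha⟩ : ∃ a : ℝ≥0, (a : ℝ) = (c : ℝ) / (2 * (1 + ∑ j, (κ j : ℝ))) :=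
    ⟨⟨(c : ℝ) / (2 * (1 + ∑ j, (κ j : ℝ))), by positivity⟩, rfl⟩
  have haR : (0 : ℝ) < a := by rw [ha]; positivity
  have hden : (0 : ℝ) < 2 * (1 + ∑ j, (κ j : ℝ)) := by positivity
  refine ⟨a, by exact_mod_cast haR, ?_, fun i => ⟨?_, ?_⟩⟩
  · have h1 : (a : ℝ) < c := by
      rw [ha, div_lt_iff₀ hden]
      nlinarith
    exact_mod_cast h1
  · have h1 : (a : ℝ) ≤ κ i * a := by
      have := hκ i
      have hκR : (1 : ℝ) ≤ κ i := by exact_mod_cast this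
      nlinarith
    exact_mod_cast h1
  · have h1 : (κ i : ℝ) * a < c := by
      rw [ha, mul_div_assoc', div_lt_iff₀ hden]
      have hκ0 : (0 : ℝ) ≤ κ i := NNReal.coe_nonneg _
      nlinarith [hS i]
    exact_mod_cast h1

/-! ## §2 Lifting `GL₂(𝔸_L)` test functions to `U(J₂)(𝔸)` -/

section Lift

variable {F E : Type} [Field F] [NumberField F] [Field E] [NumberField E] [Algebra F E] {c : E ≃ₐ[F] E} {N : ℕ} [NeZero N]

omit [NeZero N] in
/-- The lift `x ↦ (η (adelicVal x) : ℂ)` of a continuous `η` is continuous (`adelicVal` is a closed embedding). [folklore] -/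
theorem continuous_lift {η : GL (Fin N) (AdeleRing (𝓞 E) E) → ℝ} (hη : Continuous η) :
    Continuous fun x : (quasiSplit F E c N).Adelic => ((η (adelicVal F E c N ((StdForm.antidiagonal N).over E) x) : ℝ) : ℂ) :=
  Complex.continuous_ofReal.comp (hη.comp (isClosed_adelic F E c N ((StdForm.antidiagonal N).over E)).isClosedEmbedding_subtypeVal.continuous)

omit [NeZero N] in
/-- The lift of a compactly supported `η` has compact support (closed embedding). [folklore] -/
theorem hasCompactSupport_lift {η : GL (Fin N) (AdeleRing (𝓞 E) E) → ℝ} (hη : HasCompactSupport η) :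
    HasCompactSupport fun x : (quasiSplit F E c N).Adelic => ((η (adelicVal F E c N ((StdForm.antidiagonal N).over E) x) : ℝ) : ℂ) :=
  (hη.comp_isClosedEmbedding (isClosed_adelic F E c N ((StdForm.antidiagonal N).over E)).isClosedEmbedding_subtypeVal).comp_left Complex.ofReal_zero

variable [MeasurableSpace (quasiSplit F E c N).Adelic] [BorelSpace (quasiSplit F E c N).Adelic]

omit [NeZero N] in
/-- The lift of a test function is integrable against any measure finite on compacta. [folklore] -/
theorem integrable_lift (μ : Measure (quasiSplit F E c N).Adelic) [IsFiniteMeasureOnCompacts μ] {η : GL (Fin N) (AdeleRing (𝓞 E) E) → ℝ} (hη : Continuous η)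
    (hηs : HasCompactSupport η) : Integrable (fun x : (quasiSplit F E c N).Adelic => ((η (adelicVal F E c N ((StdForm.antidiagonal N).over E) x) : ℝ) : ℂ)) μ :=
  (continuous_lift hη).integrable_of_hasCompactSupport (hasCompactSupport_lift hηs)

end Lift

/-! ## §3 The ball data for the CM datum -/

section CM

variable (L : Type) [Field L] [NumberField L] [IsCMField L]
  [MeasurableSpace (quasiSplit (↥(maximalRealSubfield L)) L (IsCMField.complexConj L) 2).Adelic] [BorelSpace (quasiSplit (↥(maximalRealSubfield L)) L (IsCMField.complexConj L) 2).Adelic]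

/-- **THE BALL DATA** [BernsteinLapid2019, §4 Claims 4–5, p. 10].  For `n : ℕ`, `k := n + 3`, and the structural data of the CM datum at `N = 2`: there are a level `a > 0`, a finite index type
with a distinguished index, smooth non-negative SYMMETRIC bi-`K`-invariant test functions `η i` on `GL₂(𝔸_L)` whose transforms `ĥ_i(z) = ∫ η_i(x)·H(x)^z dνG` have no common zero on
`ball 0 (n + 2)` and `ĥ_{i₀}(0) ≠ 0`, constants `κ i ≥ 1` with the ι-package closed/injective at the levels `κ_i a` and `μZ(Z_a) ≠ 0`, and the `𝔛`-side Hecke operators `T i` with their a.e.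
formula and, at the levels `a ≤ κ_i a`, the letters `ShiftBound` and the intertwining `δ_i ∘ ι = restr ∘ ι ∘ T_i`. [cite: BernsteinLapid2019, §4 Claims 4–5 and p. 10] -/
theorem exists_ballData_cm_two
    (μ : Measure (quasiSplit (↥(maximalRealSubfield L)) L (IsCMField.complexConj L) 2).automorphicQuotient)
    [(quasiSplit (↥(maximalRealSubfield L)) L (IsCMField.complexConj L) 2).IsAutomorphicMeasure μ]
    (νG : Measure (quasiSplit (↥(maximalRealSubfield L)) L (IsCMField.complexConj L) 2).Adelic) [νG.IsHaarMeasure] [νG.IsInvInvariant] [SFinite νG]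
    {β : (quasiSplit (↥(maximalRealSubfield L)) L (IsCMField.complexConj L) 2).Adelic → ℝ≥0∞}
    (hβ : IsCoveringWeight ↥((arithmeticBorel (↥(maximalRealSubfield L)) L (IsCMField.complexConj L) 2).map
      (quasiSplit (↥(maximalRealSubfield L)) L (IsCMField.complexConj L) 2).arithmeticSubgroup.subtype) β)
    {μZ : Measure (borelQuotient (↥(maximalRealSubfield L)) L (IsCMField.complexConj L) 2)} [SFinite μZ]
    (hμZ : ∀ f : borelQuotient (↥(maximalRealSubfield L)) L (IsCMField.complexConj L) 2 → ℝ≥0∞, Measurable f →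
      ∫⁻ z, f z ∂μZ = ∫⁻ g, β g * f (toBorelQuotient (↥(maximalRealSubfield L)) L (IsCMField.complexConj L) 2 g) ∂νG) (n : ℕ) :
    ∃ (a : ℝ≥0) (ha : 0 < a) (I : Type) (_ : Fintype I) (i₀ : I) (η : I → GL (Fin 2) (AdeleRing (𝓞 L) L) → ℝ) (κ : I → ℝ≥0)
      (T : I → HX (↥(maximalRealSubfield L)) L (IsCMField.complexConj L) 2 (n + 3) μ →L[ℂ] HX (↥(maximalRealSubfield L)) L (IsCMField.complexConj L) 2 (n + 3) μ),
      (∀ i, IsTestFunctionGL 2 L (η i) ∧ (∀ g, 0 ≤ η i g) ∧ (∀ g, η i g⁻¹ = η i g) ∧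
        ∀ k₁ k₂ : (quasiSplit (↥(maximalRealSubfield L)) L (IsCMField.complexConj L) 2).Adelic,
          adelicVal (↥(maximalRealSubfield L)) L (IsCMField.complexConj L) 2 ((StdForm.antidiagonal 2).over L) k₁ ∈ standardMaximalCompactGL 2 L →
          adelicVal (↥(maximalRealSubfield L)) L (IsCMField.complexConj L) 2 ((StdForm.antidiagonal 2).over L) k₂ ∈ standardMaximalCompactGL 2 L →
            ∀ x, η i (adelicVal (↥(maximalRealSubfield L)) L (IsCMField.complexConj L) 2 ((StdForm.antidiagonal 2).over L) (k₁ * x * k₂)) =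
              η i (adelicVal (↥(maximalRealSubfield L)) L (IsCMField.complexConj L) 2 ((StdForm.antidiagonal 2).over L) x)) ∧
      (∀ z ∈ Metric.ball (0 : ℂ) (n + 2), ∃ i, (∫ x, ((η i (adelicVal (↥(maximalRealSubfield L)) L (IsCMField.complexConj L) 2 ((StdForm.antidiagonal 2).over L) x) : ℝ) : ℂ) *
        (((borelHeight x : ℝ≥0) : ℝ) : ℂ) ^ z ∂νG) ≠ 0) ∧
      (∫ x, ((η i₀ (adelicVal (↥(maximalRealSubfield L)) L (IsCMField.complexConj L) 2 ((StdForm.antidiagonal 2).over L) x) : ℝ) : ℂ) * (((borelHeight x : ℝ≥0) : ℝ) : ℂ) ^ (0 : ℂ) ∂νG) ≠ 0 ∧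
      (∀ i, 1 ≤ κ i ∧ a ≤ κ i * a) ∧
      (∀ i, ∃ hpos : 0 < κ i * a, Function.Injective (iota (iotaBound_cm L μ νG hβ hμZ hpos (n + 3))) ∧
        IsClosed ((LinearMap.range (iota (iotaBound_cm L μ νG hβ hμZ hpos (n + 3))).toLinearMap :
          Submodule ℂ (HN (↥(maximalRealSubfield L)) L (IsCMField.complexConj L) 2 (n + 3) (κ i * a) μZ)) : Set (HN (↥(maximalRealSubfield L)) L (IsCMField.complexConj L) 2 (n + 3) (κ i * a) μZ))) ∧
      μZ {z | a < borelQuotHeight (↥(maximalRealSubfield L)) L (IsCMField.complexConj L) 2 z} ≠ 0 ∧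
      (∀ i, ∀ u : HX (↥(maximalRealSubfield L)) L (IsCMField.complexConj L) 2 (n + 3) μ,
        (T i u : (quasiSplit (↥(maximalRealSubfield L)) L (IsCMField.complexConj L) 2).automorphicQuotient → ℂ) =ᵐ[μ.withDensity fun x =>
            (((supHeight (↥(maximalRealSubfield L)) L (IsCMField.complexConj L) 2 x)⁻¹ ^ (2 * (n + 3)) : ℝ≥0) : ℝ≥0∞)]
          fun ξ => ∫ y, ((η i (adelicVal (↥(maximalRealSubfield L)) L (IsCMField.complexConj L) 2 ((StdForm.antidiagonal 2).over L) y) : ℝ) : ℂ) *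
            (u : (quasiSplit (↥(maximalRealSubfield L)) L (IsCMField.complexConj L) 2).automorphicQuotient → ℂ) (y⁻¹ • ξ) ∂νG) ∧
      (∀ i, ∃ hs : ShiftBound (↥(maximalRealSubfield L)) L (IsCMField.complexConj L) 2 (n + 3) a (κ i * a) νG μZ
          (fun x => ((η i (adelicVal (↥(maximalRealSubfield L)) L (IsCMField.complexConj L) 2 ((StdForm.antidiagonal 2).over L) x) : ℝ) : ℂ)),
        ∀ (h01 : a ≤ κ i * a),
          deltaShift hs ∘L iota (iotaBound_cm L μ νG hβ hμZ ha (n + 3)) =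
            restrHN (↥(maximalRealSubfield L)) L (IsCMField.complexConj L) 2 (n + 3) h01 μZ ∘L iota (iotaBound_cm L μ νG hβ hμZ ha (n + 3)) ∘L T i) := by
  -- a symmetric smooth test function with `ĥ(z₀) ≠ 0` for every `z₀`
  have hfam : ∀ z₀ : ℂ, ∃ η : GL (Fin 2) (AdeleRing (𝓞 L) L) → ℝ, IsTestFunctionGL 2 L η ∧ (∀ g, 0 ≤ η g) ∧ (∀ g, η g⁻¹ = η g) ∧
      (∀ k₁ k₂ : (quasiSplit (↥(maximalRealSubfield L)) L (IsCMField.complexConj L) 2).Adelic,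
          adelicVal (↥(maximalRealSubfield L)) L (IsCMField.complexConj L) 2 ((StdForm.antidiagonal 2).over L) k₁ ∈ standardMaximalCompactGL 2 L →
          adelicVal (↥(maximalRealSubfield L)) L (IsCMField.complexConj L) 2 ((StdForm.antidiagonal 2).over L) k₂ ∈ standardMaximalCompactGL 2 L →
            ∀ x, η (adelicVal (↥(maximalRealSubfield L)) L (IsCMField.complexConj L) 2 ((StdForm.antidiagonal 2).over L) (k₁ * x * k₂)) =
              η (adelicVal (↥(maximalRealSubfield L)) L (IsCMField.complexConj L) 2 ((StdForm.antidiagonal 2).over L) x)) ∧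
      (∫ x, ((η (adelicVal (↥(maximalRealSubfield L)) L (IsCMField.complexConj L) 2 ((StdForm.antidiagonal 2).over L) x) : ℝ) : ℂ) * (((borelHeight x : ℝ≥0) : ℝ) : ℂ) ^ z₀ ∂νG) ≠ 0 := by
    intro z₀
    obtain ⟨η, hη, h0, hsymm, -, hK, hne⟩ := exists_symm_isTestFunctionGL_biInvariant_integral_ne_zero (F := ↥(maximalRealSubfield L)) (E := L)
      (c := IsCMField.complexConj L) (N := 2) νG z₀
    exact ⟨η, hη, h0, hsymm, hK, hne⟩
  choose η hηt hη0 hηsymm hηK hηne using hfam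
  -- the transforms are continuous, so finitely many `z₀` serve the closed ball
  have hcont : ∀ z₀ : ℂ, Continuous fun z : ℂ => ∫ x, ((η z₀ (adelicVal (↥(maximalRealSubfield L)) L (IsCMField.complexConj L) 2 ((StdForm.antidiagonal 2).over L) x) : ℝ) : ℂ) *
      (((borelHeight x : ℝ≥0) : ℝ) : ℂ) ^ z ∂νG := fun z₀ =>
    (differentiable_integral_mul_borelHeight_cpow νG (continuous_lift (hηt z₀).continuous) (hasCompactSupport_lift (hηt z₀).hasCompactSupport)).continuous
  obtain ⟨s, hs⟩ := exists_finset_forall_exists_ne_zero_closedBall hcont (fun z => ⟨z, hηne z⟩) ((n : ℝ) + 2)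
  -- the index type `Option s`: `none ↦ η 0`, `some z ↦ η z`
  obtain ⟨ηI, hηI⟩ : ∃ ηI : Option ↥s → GL (Fin 2) (AdeleRing (𝓞 L) L) → ℝ, ηI = fun o : Option ↥s => Option.elim o (η 0) fun z : ↥s => η (z : ℂ) := ⟨_, rfl⟩
  have hηIn : ηI none = η 0 := by rw [hηI]; rfl
  have hηIs : ∀ z : ↥s, ηI (some z) = η (z : ℂ) := fun z => by rw [hηI]; rfl
  have hηI' : ∀ o : Option ↥s, ∃ z₀ : ℂ, ηI o = η z₀ := fun o => by
    cases o with
    | none => exact ⟨0, hηIn⟩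
    | some z => exact ⟨z, hηIs z⟩
  -- Hecke packages (★), with `hright` from the unfolding (`νG` is right invariant: `νG⁻¹ = νG` and left invariance)
  haveI : νG.IsMulRightInvariant := by rw [← Measure.inv_eq_self νG]; infer_instance
  have hright := measurePreserving_rightShift_of_unfolding νG hβ hμZ
  have hpk : ∀ o : Option ↥s, ∃ κ : ℝ≥0, 1 ≤ κ ∧ ∃ T : HX (↥(maximalRealSubfield L)) L (IsCMField.complexConj L) 2 (n + 3) μ →L[ℂ] HX (↥(maximalRealSubfield L)) L (IsCMField.complexConj L) 2 (n + 3) μ,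
      (∀ u : HX (↥(maximalRealSubfield L)) L (IsCMField.complexConj L) 2 (n + 3) μ,
        (T u : (quasiSplit (↥(maximalRealSubfield L)) L (IsCMField.complexConj L) 2).automorphicQuotient → ℂ) =ᵐ[μ.withDensity fun x =>
            (((supHeight (↥(maximalRealSubfield L)) L (IsCMField.complexConj L) 2 x)⁻¹ ^ (2 * (n + 3)) : ℝ≥0) : ℝ≥0∞)]
          fun ξ => ∫ y, ((ηI o (adelicVal (↥(maximalRealSubfield L)) L (IsCMField.complexConj L) 2 ((StdForm.antidiagonal 2).over L) y) : ℝ) : ℂ) *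
            (u : (quasiSplit (↥(maximalRealSubfield L)) L (IsCMField.complexConj L) 2).automorphicQuotient → ℂ) (y⁻¹ • ξ) ∂νG) ∧
      ∀ (c₁ c₀ : ℝ≥0) (h01 : c₁ ≤ c₀), κ * c₁ ≤ c₀ → ∃ hs : ShiftBound (↥(maximalRealSubfield L)) L (IsCMField.complexConj L) 2 (n + 3) c₁ c₀ νG μZ
          (fun x => ((ηI o (adelicVal (↥(maximalRealSubfield L)) L (IsCMField.complexConj L) 2 ((StdForm.antidiagonal 2).over L) x) : ℝ) : ℂ)),
        ∀ hb : IotaBound (↥(maximalRealSubfield L)) L (IsCMField.complexConj L) 2 (n + 3) c₁ μ μZ,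
          deltaShift hs ∘L iota hb = restrHN (↥(maximalRealSubfield L)) L (IsCMField.complexConj L) 2 (n + 3) h01 μZ ∘L iota hb ∘L T := by
    intro o
    obtain ⟨z₀, hz₀⟩ := hηI' o
    rw [hz₀]
    exact exists_heckePackage νG μ μZ hright (continuous_lift (hηt z₀).continuous) (hasCompactSupport_lift (hηt z₀).hasCompactSupport)
      (integrable_lift νG (hηt z₀).continuous (hηt z₀).hasCompactSupport) (n + 3)
  choose κ hκ T hT hpack using hpk
  -- thresholds and levels
  obtain ⟨c₁, hc₁, hι⟩ := exists_pos_iota_closedEmbedding_cm L μ νG hβ hμZ (n + 3)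
  obtain ⟨c₂, hc₂, hne⟩ := exists_pos_forall_measure_setOf_lt_ne_zero_cm L μ νG hβ hμZ (n + 3)
  obtain ⟨a, ha, hac, hlev⟩ := exists_levels κ hκ (lt_min hc₁ hc₂)
  refine ⟨a, ha, Option ↥s, inferInstance, none, ηI, κ, T, fun o => ?_, fun z hz => ?_, ?_, fun o => ⟨hκ o, (hlev o).1⟩, fun o => ?_,
    hne a ha (hac.trans_le (min_le_right _ _)), hT, fun o => ?_⟩
  · obtain ⟨z₀, hz₀⟩ := hηI' o
    rw [hz₀]
    exact ⟨hηt z₀, hη0 z₀, hηsymm z₀, hηK z₀⟩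
  · obtain ⟨z₀, hz₀s, hz₀⟩ := hs z (Metric.ball_subset_closedBall hz)
    exact ⟨some ⟨z₀, hz₀s⟩, by rw [hηIs]; exact hz₀⟩
  · rw [hηIn]; exact hηne 0
  · have hpos : 0 < κ o * a := lt_of_lt_of_le ha (hlev o).1
    obtain ⟨-, hinj, hcl⟩ := hι (κ o * a) hpos ((hlev o).2.trans_le (min_le_left _ _))
    exact ⟨hpos, hinj, hcl⟩
  · obtain ⟨hs', hδι⟩ := hpack o a (κ o * a) (hlev o).1 le_rfl
    exact ⟨hs', fun h01 => hδι (iotaBound_cm L μ νG hβ hμZ ha (n + 3))⟩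

/-- **THE BALL DATA, WITH THE HEIGHT COMPARISONS EXPORTED** (ED. 2) [BernsteinLapid2019, §4 Claims 4–5, p. 10]: as `exists_ballData_cm_two`, plus for every `i` the one-sided comparison `HZ z ≤ κ_i·HZ(z·y)` on `tsupport` of the lift of `η i` with the SAME `κ i` (input of P6′ (i)'s `hδα₂` payment).  For `n : ℕ`, `k := n + 3`, and the structural data of the CM datum at `N = 2`: there are a level `a > 0`, a finite index type
with a distinguished index, smooth non-negative SYMMETRIC bi-`K`-invariant test functions `η i` on `GL₂(𝔸_L)` whose transforms `ĥ_i(z) = ∫ η_i(x)·H(x)^z dνG` have no common zero on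
`ball 0 (n + 2)` and `ĥ_{i₀}(0) ≠ 0`, constants `κ i ≥ 1` with the ι-package closed/injective at the levels `κ_i a` and `μZ(Z_a) ≠ 0`, and the `𝔛`-side Hecke operators `T i` with their a.e.
formula and, at the levels `a ≤ κ_i a`, the letters `ShiftBound` and the intertwining `δ_i ∘ ι = restr ∘ ι ∘ T_i`. [cite: BernsteinLapid2019, §4 Claims 4–5 and p. 10] -/
theorem exists_ballData_cm_two'
    (μ : Measure (quasiSplit (↥(maximalRealSubfield L)) L (IsCMField.complexConj L) 2).automorphicQuotient)
    [(quasiSplit (↥(maximalRealSubfield L)) L (IsCMField.complexConj L) 2).IsAutomorphicMeasure μ]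
    (νG : Measure (quasiSplit (↥(maximalRealSubfield L)) L (IsCMField.complexConj L) 2).Adelic) [νG.IsHaarMeasure] [νG.IsInvInvariant] [SFinite νG]
    {β : (quasiSplit (↥(maximalRealSubfield L)) L (IsCMField.complexConj L) 2).Adelic → ℝ≥0∞}
    (hβ : IsCoveringWeight ↥((arithmeticBorel (↥(maximalRealSubfield L)) L (IsCMField.complexConj L) 2).map
      (quasiSplit (↥(maximalRealSubfield L)) L (IsCMField.complexConj L) 2).arithmeticSubgroup.subtype) β)
    {μZ : Measure (borelQuotient (↥(maximalRealSubfield L)) L (IsCMField.complexConj L) 2)} [SFinite μZ]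
    (hμZ : ∀ f : borelQuotient (↥(maximalRealSubfield L)) L (IsCMField.complexConj L) 2 → ℝ≥0∞, Measurable f →
      ∫⁻ z, f z ∂μZ = ∫⁻ g, β g * f (toBorelQuotient (↥(maximalRealSubfield L)) L (IsCMField.complexConj L) 2 g) ∂νG) (n : ℕ) :
    ∃ (a : ℝ≥0) (ha : 0 < a) (I : Type) (_ : Fintype I) (i₀ : I) (η : I → GL (Fin 2) (AdeleRing (𝓞 L) L) → ℝ) (κ : I → ℝ≥0)
      (T : I → HX (↥(maximalRealSubfield L)) L (IsCMField.complexConj L) 2 (n + 3) μ →L[ℂ] HX (↥(maximalRealSubfield L)) L (IsCMField.complexConj L) 2 (n + 3) μ),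
      (∀ i, IsTestFunctionGL 2 L (η i) ∧ (∀ g, 0 ≤ η i g) ∧ (∀ g, η i g⁻¹ = η i g) ∧
        ∀ k₁ k₂ : (quasiSplit (↥(maximalRealSubfield L)) L (IsCMField.complexConj L) 2).Adelic,
          adelicVal (↥(maximalRealSubfield L)) L (IsCMField.complexConj L) 2 ((StdForm.antidiagonal 2).over L) k₁ ∈ standardMaximalCompactGL 2 L →
          adelicVal (↥(maximalRealSubfield L)) L (IsCMField.complexConj L) 2 ((StdForm.antidiagonal 2).over L) k₂ ∈ standardMaximalCompactGL 2 L →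
            ∀ x, η i (adelicVal (↥(maximalRealSubfield L)) L (IsCMField.complexConj L) 2 ((StdForm.antidiagonal 2).over L) (k₁ * x * k₂)) =
              η i (adelicVal (↥(maximalRealSubfield L)) L (IsCMField.complexConj L) 2 ((StdForm.antidiagonal 2).over L) x)) ∧
      (∀ z ∈ Metric.ball (0 : ℂ) (n + 2), ∃ i, (∫ x, ((η i (adelicVal (↥(maximalRealSubfield L)) L (IsCMField.complexConj L) 2 ((StdForm.antidiagonal 2).over L) x) : ℝ) : ℂ) *
        (((borelHeight x : ℝ≥0) : ℝ) : ℂ) ^ z ∂νG) ≠ 0) ∧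
      (∫ x, ((η i₀ (adelicVal (↥(maximalRealSubfield L)) L (IsCMField.complexConj L) 2 ((StdForm.antidiagonal 2).over L) x) : ℝ) : ℂ) * (((borelHeight x : ℝ≥0) : ℝ) : ℂ) ^ (0 : ℂ) ∂νG) ≠ 0 ∧
      (∀ i, 1 ≤ κ i ∧ a ≤ κ i * a) ∧
      (∀ i, ∀ z : borelQuotient (↥(maximalRealSubfield L)) L (IsCMField.complexConj L) 2,
        ∀ y ∈ tsupport (fun x : (quasiSplit (↥(maximalRealSubfield L)) L (IsCMField.complexConj L) 2).Adelic =>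
          ((η i (adelicVal (↥(maximalRealSubfield L)) L (IsCMField.complexConj L) 2 ((StdForm.antidiagonal 2).over L) x) : ℝ) : ℂ)),
          borelQuotHeight (↥(maximalRealSubfield L)) L (IsCMField.complexConj L) 2 z ≤
            κ i * borelQuotHeight (↥(maximalRealSubfield L)) L (IsCMField.complexConj L) 2 (rightShift (↥(maximalRealSubfield L)) L (IsCMField.complexConj L) 2 y z)) ∧
      (∀ i, ∃ hpos : 0 < κ i * a, Function.Injective (iota (iotaBound_cm L μ νG hβ hμZ hpos (n + 3))) ∧
        IsClosed ((LinearMap.range (iota (iotaBound_cm L μ νG hβ hμZ hpos (n + 3))).toLinearMap :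
          Submodule ℂ (HN (↥(maximalRealSubfield L)) L (IsCMField.complexConj L) 2 (n + 3) (κ i * a) μZ)) : Set (HN (↥(maximalRealSubfield L)) L (IsCMField.complexConj L) 2 (n + 3) (κ i * a) μZ))) ∧
      μZ {z | a < borelQuotHeight (↥(maximalRealSubfield L)) L (IsCMField.complexConj L) 2 z} ≠ 0 ∧
      (∀ i, ∀ u : HX (↥(maximalRealSubfield L)) L (IsCMField.complexConj L) 2 (n + 3) μ,
        (T i u : (quasiSplit (↥(maximalRealSubfield L)) L (IsCMField.complexConj L) 2).automorphicQuotient → ℂ) =ᵐ[μ.withDensity fun x =>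
            (((supHeight (↥(maximalRealSubfield L)) L (IsCMField.complexConj L) 2 x)⁻¹ ^ (2 * (n + 3)) : ℝ≥0) : ℝ≥0∞)]
          fun ξ => ∫ y, ((η i (adelicVal (↥(maximalRealSubfield L)) L (IsCMField.complexConj L) 2 ((StdForm.antidiagonal 2).over L) y) : ℝ) : ℂ) *
            (u : (quasiSplit (↥(maximalRealSubfield L)) L (IsCMField.complexConj L) 2).automorphicQuotient → ℂ) (y⁻¹ • ξ) ∂νG) ∧
      (∀ i, ∃ hs : ShiftBound (↥(maximalRealSubfield L)) L (IsCMField.complexConj L) 2 (n + 3) a (κ i * a) νG μZ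
          (fun x => ((η i (adelicVal (↥(maximalRealSubfield L)) L (IsCMField.complexConj L) 2 ((StdForm.antidiagonal 2).over L) x) : ℝ) : ℂ)),
        ∀ (h01 : a ≤ κ i * a),
          deltaShift hs ∘L iota (iotaBound_cm L μ νG hβ hμZ ha (n + 3)) =
            restrHN (↥(maximalRealSubfield L)) L (IsCMField.complexConj L) 2 (n + 3) h01 μZ ∘L iota (iotaBound_cm L μ νG hβ hμZ ha (n + 3)) ∘L T i) := by
  -- a symmetric smooth test function with `ĥ(z₀) ≠ 0` for every `z₀`
  have hfam : ∀ z₀ : ℂ, ∃ η : GL (Fin 2) (AdeleRing (𝓞 L) L) → ℝ, IsTestFunctionGL 2 L η ∧ (∀ g, 0 ≤ η g) ∧ (∀ g, η g⁻¹ = η g) ∧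
      (∀ k₁ k₂ : (quasiSplit (↥(maximalRealSubfield L)) L (IsCMField.complexConj L) 2).Adelic,
          adelicVal (↥(maximalRealSubfield L)) L (IsCMField.complexConj L) 2 ((StdForm.antidiagonal 2).over L) k₁ ∈ standardMaximalCompactGL 2 L →
          adelicVal (↥(maximalRealSubfield L)) L (IsCMField.complexConj L) 2 ((StdForm.antidiagonal 2).over L) k₂ ∈ standardMaximalCompactGL 2 L →
            ∀ x, η (adelicVal (↥(maximalRealSubfield L)) L (IsCMField.complexConj L) 2 ((StdForm.antidiagonal 2).over L) (k₁ * x * k₂)) =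
              η (adelicVal (↥(maximalRealSubfield L)) L (IsCMField.complexConj L) 2 ((StdForm.antidiagonal 2).over L) x)) ∧
      (∫ x, ((η (adelicVal (↥(maximalRealSubfield L)) L (IsCMField.complexConj L) 2 ((StdForm.antidiagonal 2).over L) x) : ℝ) : ℂ) * (((borelHeight x : ℝ≥0) : ℝ) : ℂ) ^ z₀ ∂νG) ≠ 0 := by
    intro z₀
    obtain ⟨η, hη, h0, hsymm, -, hK, hne⟩ := exists_symm_isTestFunctionGL_biInvariant_integral_ne_zero (F := ↥(maximalRealSubfield L)) (E := L)
      (c := IsCMField.complexConj L) (N := 2) νG z₀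
    exact ⟨η, hη, h0, hsymm, hK, hne⟩
  choose η hηt hη0 hηsymm hηK hηne using hfam
  -- the transforms are continuous, so finitely many `z₀` serve the closed ball
  have hcont : ∀ z₀ : ℂ, Continuous fun z : ℂ => ∫ x, ((η z₀ (adelicVal (↥(maximalRealSubfield L)) L (IsCMField.complexConj L) 2 ((StdForm.antidiagonal 2).over L) x) : ℝ) : ℂ) *
      (((borelHeight x : ℝ≥0) : ℝ) : ℂ) ^ z ∂νG := fun z₀ =>
    (differentiable_integral_mul_borelHeight_cpow νG (continuous_lift (hηt z₀).continuous) (hasCompactSupport_lift (hηt z₀).hasCompactSupport)).continuous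
  obtain ⟨s, hs⟩ := exists_finset_forall_exists_ne_zero_closedBall hcont (fun z => ⟨z, hηne z⟩) ((n : ℝ) + 2)
  -- the index type `Option s`: `none ↦ η 0`, `some z ↦ η z`
  obtain ⟨ηI, hηI⟩ : ∃ ηI : Option ↥s → GL (Fin 2) (AdeleRing (𝓞 L) L) → ℝ, ηI = fun o : Option ↥s => Option.elim o (η 0) fun z : ↥s => η (z : ℂ) := ⟨_, rfl⟩
  have hηIn : ηI none = η 0 := by rw [hηI]; rfl
  have hηIs : ∀ z : ↥s, ηI (some z) = η (z : ℂ) := fun z => by rw [hηI]; rfl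
  have hηI' : ∀ o : Option ↥s, ∃ z₀ : ℂ, ηI o = η z₀ := fun o => by
    cases o with
    | none => exact ⟨0, hηIn⟩
    | some z => exact ⟨z, hηIs z⟩
  -- Hecke packages (★), with `hright` from the unfolding (`νG` is right invariant: `νG⁻¹ = νG` and left invariance)
  haveI : νG.IsMulRightInvariant := by rw [← Measure.inv_eq_self νG]; infer_instance
  have hright := measurePreserving_rightShift_of_unfolding νG hβ hμZ
  have hpk : ∀ o : Option ↥s, ∃ κ : ℝ≥0, 1 ≤ κ ∧
      (∀ z : borelQuotient (↥(maximalRealSubfield L)) L (IsCMField.complexConj L) 2,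
        ∀ y ∈ tsupport (fun x : (quasiSplit (↥(maximalRealSubfield L)) L (IsCMField.complexConj L) 2).Adelic =>
          ((ηI o (adelicVal (↥(maximalRealSubfield L)) L (IsCMField.complexConj L) 2 ((StdForm.antidiagonal 2).over L) x) : ℝ) : ℂ)),
          borelQuotHeight (↥(maximalRealSubfield L)) L (IsCMField.complexConj L) 2 z ≤
            κ * borelQuotHeight (↥(maximalRealSubfield L)) L (IsCMField.complexConj L) 2 (rightShift (↥(maximalRealSubfield L)) L (IsCMField.complexConj L) 2 y z)) ∧ ∃ T : HX (↥(maximalRealSubfield L)) L (IsCMField.complexConj L) 2 (n + 3) μ →L[ℂ] HX (↥(maximalRealSubfield L)) L (IsCMField.complexConj L) 2 (n + 3) μ,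
      (∀ u : HX (↥(maximalRealSubfield L)) L (IsCMField.complexConj L) 2 (n + 3) μ,
        (T u : (quasiSplit (↥(maximalRealSubfield L)) L (IsCMField.complexConj L) 2).automorphicQuotient → ℂ) =ᵐ[μ.withDensity fun x =>
            (((supHeight (↥(maximalRealSubfield L)) L (IsCMField.complexConj L) 2 x)⁻¹ ^ (2 * (n + 3)) : ℝ≥0) : ℝ≥0∞)]
          fun ξ => ∫ y, ((ηI o (adelicVal (↥(maximalRealSubfield L)) L (IsCMField.complexConj L) 2 ((StdForm.antidiagonal 2).over L) y) : ℝ) : ℂ) *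
            (u : (quasiSplit (↥(maximalRealSubfield L)) L (IsCMField.complexConj L) 2).automorphicQuotient → ℂ) (y⁻¹ • ξ) ∂νG) ∧
      ∀ (c₁ c₀ : ℝ≥0) (h01 : c₁ ≤ c₀), κ * c₁ ≤ c₀ → ∃ hs : ShiftBound (↥(maximalRealSubfield L)) L (IsCMField.complexConj L) 2 (n + 3) c₁ c₀ νG μZ
          (fun x => ((ηI o (adelicVal (↥(maximalRealSubfield L)) L (IsCMField.complexConj L) 2 ((StdForm.antidiagonal 2).over L) x) : ℝ) : ℂ)),
        ∀ hb : IotaBound (↥(maximalRealSubfield L)) L (IsCMField.complexConj L) 2 (n + 3) c₁ μ μZ,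
          deltaShift hs ∘L iota hb = restrHN (↥(maximalRealSubfield L)) L (IsCMField.complexConj L) 2 (n + 3) h01 μZ ∘L iota hb ∘L T := by
    intro o
    obtain ⟨z₀, hz₀⟩ := hηI' o
    rw [hz₀]
    exact Summit.HodgeConjecture.HodgeConjecture.Cruxes.H413.K2E1SphericalEisensteinMeromorphicSuppliersU2.exists_heckePackage' νG μ μZ hright (continuous_lift (hηt z₀).continuous) (hasCompactSupport_lift (hηt z₀).hasCompactSupport)
      (integrable_lift νG (hηt z₀).continuous (hηt z₀).hasCompactSupport) (n + 3)
  choose κ hκ hcmp T hT hpack using hpk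
  -- thresholds and levels
  obtain ⟨c₁, hc₁, hι⟩ := exists_pos_iota_closedEmbedding_cm L μ νG hβ hμZ (n + 3)
  obtain ⟨c₂, hc₂, hne⟩ := exists_pos_forall_measure_setOf_lt_ne_zero_cm L μ νG hβ hμZ (n + 3)
  obtain ⟨a, ha, hac, hlev⟩ := exists_levels κ hκ (lt_min hc₁ hc₂)
  refine ⟨a, ha, Option ↥s, inferInstance, none, ηI, κ, T, fun o => ?_, fun z hz => ?_, ?_, fun o => ⟨hκ o, (hlev o).1⟩, hcmp, fun o => ?_,
    hne a ha (hac.trans_le (min_le_right _ _)), hT, fun o => ?_⟩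
  · obtain ⟨z₀, hz₀⟩ := hηI' o
    rw [hz₀]
    exact ⟨hηt z₀, hη0 z₀, hηsymm z₀, hηK z₀⟩
  · obtain ⟨z₀, hz₀s, hz₀⟩ := hs z (Metric.ball_subset_closedBall hz)
    exact ⟨some ⟨z₀, hz₀s⟩, by rw [hηIs]; exact hz₀⟩
  · rw [hηIn]; exact hηne 0
  · have hpos : 0 < κ o * a := lt_of_lt_of_le ha (hlev o).1
    obtain ⟨-, hinj, hcl⟩ := hι (κ o * a) hpos ((hlev o).2.trans_le (min_le_left _ _))
    exact ⟨hpos, hinj, hcl⟩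
  · obtain ⟨hs', hδι⟩ := hpack o a (κ o * a) (hlev o).1 le_rfl
    exact ⟨hs', fun h01 => hδι (iotaBound_cm L μ νG hβ hμZ ha (n + 3))⟩

end CM

end Summit.HodgeConjecture.HodgeConjecture.Cruxes.H413.K2E1SphericalEisensteinMeromorphicBallDataCMTwo

end
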